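import Summits.Parity.GeneralizedHardyLittlewood.Theorems.LiouvilleShiftedTablesSieveToMAvgSizeI2
import Literature.NumberTheory.Sieve.ShiuTheoremProofs

/-!
# Sieve glue for `SieveToMAvg`, part 12e: the absolute constants

Support file for item stmt-Parity-14274 (route `LiouvilleShiftedTables`).  The constants of the
final assembly, all from PROVED results of the tree: the uniform divisor power sum bounds for the
exponents `2j, 4j` (`j ≤ 3`) with the common logarithmic exponent `e = 8192 = 2^{13}`
(`exists_divisor_consts`), the logarithmic divisor sum `Dτ'` (`exists_Dtau'_const`), the totient sum
`∑_{q≤Q} 1/φ(q) ≪ (log Y)^4` (`exists_totient_const`), Shiu's theorem for `τ^{2j}` on short intervals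
in progressions (`exists_shiu_consts`, from `Literature.NumberTheory.Sieve.Shiu1980BrunTitchmarsh_holds`),
and the initial-segment bound `∑_{h<n≤N₀} τ(n−h) Λ(n) ≤ log N₀ · Dτ(1, N₀)` (`init_le`).
-/

namespace Summit.Parity.GeneralizedHardyLittlewood.Theorems.SieveToMAvg

open Finset Real Filter
open scoped ArithmeticFunction.zeta ArithmeticFunction.sigma ArithmeticFunction.vonMangoldt

/-- **Divisor power sum constants**: one `Cτ ≥ 1` with `Dτ(4j, Y), Dτ(2j, Y) ≤ Cτ Y (1+log Y)^{8192}`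
for `Y ≥ 1`, `j ∈ {1,2,3}`. [folklore] -/
theorem exists_divisor_consts : ∃ Cτ : ℝ, 1 ≤ Cτ ∧ ∀ j ∈ Icc 1 3,
    (∀ Y : ℝ, 1 ≤ Y → Dtau (4 * j) Y ≤ Cτ * Y * (1 + Real.log Y) ^ 8192) ∧
    (∀ Y : ℝ, 1 ≤ Y → Dtau (2 * j) Y ≤ Cτ * Y * (1 + Real.log Y) ^ 8192) := by
  -- one constant per exponent `r ≤ 12`, then the maximum
  have hr : ∀ r : ℕ, r ≤ 12 → ∃ C : ℝ, 1 ≤ C ∧ ∀ Y : ℝ, 1 ≤ Y → Dtau r Y ≤ C * Y * (1 + Real.log Y) ^ 8192 := by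
    intro r hr
    obtain ⟨C, hC, hb⟩ := exists_Dtau_le r
    refine ⟨C, hC, fun Y hY => (hb Y hY).trans ?_⟩
    have h1 : (1 : ℝ) ≤ 1 + Real.log Y := by linarith [Real.log_nonneg hY]
    refine mul_le_mul_of_nonneg_left (pow_le_pow_right₀ h1 ?_) (by nlinarith)
    calc 2 ^ (r + 1) ≤ 2 ^ 13 := Nat.pow_le_pow_right (by norm_num) (by omega)
      _ = 8192 := by norm_num
  obtain ⟨C2, hC2, h2⟩ := hr 2 (by norm_num)
  obtain ⟨C4, hC4, h4⟩ := hr 4 (by norm_num)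
  obtain ⟨C6, hC6, h6⟩ := hr 6 (by norm_num)
  obtain ⟨C8, hC8, h8⟩ := hr 8 (by norm_num)
  obtain ⟨C12, hC12, h12⟩ := hr 12 (by norm_num)
  set C := max (max (max (max C2 C4) C6) C8) C12 with hCdef
  have hle : C2 ≤ C ∧ C4 ≤ C ∧ C6 ≤ C ∧ C8 ≤ C ∧ C12 ≤ C := by
    simp only [hCdef, le_max_iff, le_refl, true_or, or_true, and_self]
  have hmono : ∀ {C' : ℝ} (r : ℕ), C' ≤ C → (∀ Y : ℝ, 1 ≤ Y → Dtau r Y ≤ C' * Y * (1 + Real.log Y) ^ 8192) →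
      ∀ Y : ℝ, 1 ≤ Y → Dtau r Y ≤ C * Y * (1 + Real.log Y) ^ 8192 := by
    intro C' r hC' hb Y hY
    refine (hb Y hY).trans (mul_le_mul_of_nonneg_right (mul_le_mul_of_nonneg_right hC' (by linarith)) ?_)
    have : 0 ≤ Real.log Y := Real.log_nonneg hY
    positivity
  refine ⟨C, hC2.trans hle.1, fun j hj => ?_⟩
  obtain ⟨hj1, hj3⟩ := Finset.mem_Icc.1 hj
  interval_cases j
  · exact ⟨hmono 4 hle.2.1 h4, hmono 2 hle.1 h2⟩
  · exact ⟨hmono 8 hle.2.2.2.1 h8, hmono 4 hle.2.1 h4⟩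
  · exact ⟨hmono 12 hle.2.2.2.2 h12, hmono 6 hle.2.2.1 h6⟩

/-- **The logarithmic divisor sum**: `Dτ'(4j, y) ≤ C' (log y)^{8192}` for `y ≥ 2`, `j ≤ 3`. [folklore] -/
theorem exists_Dtau'_const : ∃ C' : ℝ, 0 ≤ C' ∧ ∀ j : ℕ, j ≤ 3 → ∀ y : ℝ, 2 ≤ y →
    Dtau' (4 * j) y ≤ C' * Real.log y ^ 8192 := by
  obtain ⟨C, hC, hb⟩ := Literature.NumberTheory.Sieve.exists_sum_sigma_zero_pow_div_le_real 12
  refine ⟨C, hC.le, fun j hj y hy => ?_⟩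
  have h13 : (2 : ℕ) ^ (12 + 1) = 8192 := by norm_num
  rw [h13] at hb
  refine le_trans ?_ (hb y hy)
  unfold Dtau'
  refine Finset.sum_le_sum fun n hn => ?_
  have hn1 : 1 ≤ n := (Finset.mem_Icc.1 hn).1
  have hτ : (1 : ℝ) ≤ (σ 0 n : ℝ) := by
    exact_mod_cast Literature.NumberTheory.Sieve.one_le_sigma_zero (by omega : n ≠ 0)
  exact div_le_div_of_nonneg_right (pow_le_pow_right₀ hτ (by omega)) (Nat.cast_nonneg n)

/-- **The totient sum**: `∑_{q ≤ Q} 1/φ(q) ≤ C_φ (log Y)^4` for `Q ≤ Y`, `Y ≥ 2`. [folklore] -/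
theorem exists_totient_const : ∃ C_φ : ℝ, 0 ≤ C_φ ∧ ∀ Y : ℝ, 2 ≤ Y → ∀ Q : ℕ, (Q : ℝ) ≤ Y →
    ∑ q ∈ Icc 1 Q, ((Nat.totient q : ℝ))⁻¹ ≤ C_φ * Real.log Y ^ 4 := by
  obtain ⟨C, hC, hb⟩ := Literature.NumberTheory.Sieve.exists_sum_sigma_zero_pow_div_totient_le_real 0
  refine ⟨C, hC.le, fun Y hY Q hQ => ?_⟩
  have h4 : (2 : ℕ) ^ (0 + 2) = 4 := by norm_num
  rw [h4] at hb
  have hsub : Icc 1 Q ⊆ Icc 1 ⌊Y⌋₊ := Finset.Icc_subset_Icc_right (Nat.le_floor hQ)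
  calc ∑ q ∈ Icc 1 Q, ((Nat.totient q : ℝ))⁻¹ ≤ ∑ q ∈ Icc 1 ⌊Y⌋₊, ((Nat.totient q : ℝ))⁻¹ :=
        Finset.sum_le_sum_of_subset_of_nonneg hsub fun q _ _ => by positivity
    _ = ∑ q ∈ Icc 1 ⌊Y⌋₊, (σ 0 q : ℝ) ^ 0 / (Nat.totient q : ℝ) := by
        refine Finset.sum_congr rfl fun q _ => ?_; rw [pow_zero, one_div]
    _ ≤ C * Real.log Y ^ 4 := hb Y hY

/-- **Shiu for `τ^{2j}`, `j ∈ {1,2,3}`**, with `ε = θ = 1/4`, one constant `C_S ≥ 0` and one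
threshold `x₀` (stated for `x ≥ 1`, `y ≥ 0`, which is all we use). [cite: Shiu1980, Theorem 1] -/
theorem exists_shiu_consts : ∃ C_S x₀ : ℝ, 0 ≤ C_S ∧ ∀ j ∈ Icc 1 3,
    ∀ x y : ℝ, x₀ ≤ x → 1 ≤ x → 0 ≤ y → x ^ ((1 : ℝ) / 4) ≤ y → y ≤ x → ∀ q : ℕ, 1 ≤ q →
      (q : ℝ) < y ^ ((1 : ℝ) - 1 / 4) → ∀ a : ℕ, a.Coprime q →
        ∑ n ∈ (Icc 1 ⌊x + y⌋₊).filter (fun n : ℕ => x < n ∧ (n : ZMod q) = (a : ZMod q)), (σ 0 n : ℝ) ^ (2 * j) ≤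
          C_S * y / (Nat.totient q : ℝ) * Real.log x ^ (2 ^ (2 * j) - 1) := by
  have hS := Literature.NumberTheory.Sieve.Shiu1980BrunTitchmarsh_holds
  obtain ⟨C1, x1, hC1, h1⟩ := hS.sigma_zero_pow 2 (ε := 1 / 4) (θ := 1 / 4)
    (by norm_num) (by norm_num) (by norm_num) (by norm_num)
  obtain ⟨C2, x2, hC2, h2⟩ := hS.sigma_zero_pow 4 (ε := 1 / 4) (θ := 1 / 4)
    (by norm_num) (by norm_num) (by norm_num) (by norm_num)
  obtain ⟨C3, x3, hC3, h3⟩ := hS.sigma_zero_pow 6 (ε := 1 / 4) (θ := 1 / 4)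
    (by norm_num) (by norm_num) (by norm_num) (by norm_num)
  set C := max (max C1 C2) C3 with hCdef
  set x₀ := max (max x1 x2) x3 with hx₀def
  have hCle : C1 ≤ C ∧ C2 ≤ C ∧ C3 ≤ C := by simp only [hCdef, le_max_iff, le_refl, true_or, or_true, and_self]
  have hxle : x1 ≤ x₀ ∧ x2 ≤ x₀ ∧ x3 ≤ x₀ := by simp only [hx₀def, le_max_iff, le_refl, true_or, or_true, and_self]
  -- monotonicity of the bound in the constant (for `y ≥ 0`, `log x ≥ 0`)
  have hmono : ∀ {C' : ℝ} {r : ℕ} {x y : ℝ} {q : ℕ}, C' ≤ C → 0 ≤ y → 0 ≤ Real.log x →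
      C' * y / (Nat.totient q : ℝ) * Real.log x ^ r ≤ C * y / (Nat.totient q : ℝ) * Real.log x ^ r := by
    intro C' r x y q hC' hy hlx
    have : 0 ≤ y / (Nat.totient q : ℝ) * Real.log x ^ r := by positivity
    calc C' * y / (Nat.totient q : ℝ) * Real.log x ^ r = C' * (y / (Nat.totient q : ℝ) * Real.log x ^ r) := by ring
      _ ≤ C * (y / (Nat.totient q : ℝ) * Real.log x ^ r) := mul_le_mul_of_nonneg_right hC' this
      _ = _ := by ring
  refine ⟨C, x₀, hC1.trans hCle.1, fun j hj x y hx hx1 hy0 hxy hyx q hq hqy a ha => ?_⟩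
  have hlx : 0 ≤ Real.log x := Real.log_nonneg hx1
  obtain ⟨hj1, hj3⟩ := Finset.mem_Icc.1 hj
  interval_cases j
  · exact (h1 x y (hxle.1.trans hx) hxy hyx q hq hqy a ha).trans (hmono hCle.1 hy0 hlx)
  · exact (h2 x y (hxle.2.1.trans hx) hxy hyx q hq hqy a ha).trans (hmono hCle.2.1 hy0 hlx)
  · exact (h3 x y (hxle.2.2.trans hx) hxy hyx q hq hqy a ha).trans (hmono hCle.2.2 hy0 hlx)

/-- **The initial segment**: `∑_{h<n≤N₀} τ(n−h) Λ(n) ≤ log N₀ · Dτ(1, N₀)` (`N₀ ≥ 1`). [folklore] -/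
theorem init_le (h : ℕ) {N₀ : ℕ} (hN : 1 ≤ N₀) :
    ∑ n ∈ Ioc h N₀, (σ 0 (n - h) : ℝ) * Λ n ≤ Real.log N₀ * Dtau 1 N₀ := by
  classical
  have hN0 : (0 : ℝ) < N₀ := by exact_mod_cast hN
  calc ∑ n ∈ Ioc h N₀, (σ 0 (n - h) : ℝ) * Λ n ≤ ∑ n ∈ Ioc h N₀, (σ 0 (n - h) : ℝ) * Real.log N₀ := by
        refine Finset.sum_le_sum fun n hn => mul_le_mul_of_nonneg_left ?_ (by positivity)
        obtain ⟨hn1, hn2⟩ := Finset.mem_Ioc.1 hn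
        have hn0 : (0 : ℝ) < n := by exact_mod_cast (show 0 < n by omega)
        exact ArithmeticFunction.vonMangoldt_le_log.trans (Real.log_le_log hn0 (by exact_mod_cast hn2))
    _ = Real.log N₀ * ∑ n ∈ Ioc h N₀, (σ 0 (n - h) : ℝ) := by rw [Finset.mul_sum]; exact Finset.sum_congr rfl fun n _ => by ring
    _ ≤ Real.log N₀ * Dtau 1 N₀ := by
        refine mul_le_mul_of_nonneg_left ?_ (Real.log_nonneg (by exact_mod_cast hN))
        unfold Dtau
        rw [Nat.floor_natCast]
        -- reindex `n ↦ n - h` into `[1, N₀ - h] ⊆ [1, N₀]`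
        have hinj : Set.InjOn (fun n => n - h) (Ioc h N₀ : Set ℕ) := by
          intro a ha b hb hab
          have ha' := (Finset.mem_Ioc.1 (Finset.mem_coe.1 ha)).1
          have hb' := (Finset.mem_Ioc.1 (Finset.mem_coe.1 hb)).1
          simp only at hab; omega
        rw [← Finset.sum_image (f := fun m => (σ 0 m : ℝ)) hinj]
        simp only [pow_one]
        refine Finset.sum_le_sum_of_subset_of_nonneg (fun m hm => ?_) fun _ _ _ => by positivity
        obtain ⟨n, hn, rfl⟩ := Finset.mem_image.1 hm
        rw [Finset.mem_Ioc] at hn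
        rw [Finset.mem_Icc]; omega

end Summit.Parity.GeneralizedHardyLittlewood.Theorems.SieveToMAvg
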